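import Literature.AnabelianGeometry.AbsoluteAnabelian.AbsTopII.EllipticCuspidalizationComparison
import HarnessLib

/-!
# [AbsTopII] Cor 3.3 (ii): the group-theoretic description of the semi-elliptic double coverings is
# invariant under isomorphisms `φ : Π_{C₁} ⥲ Π_{C₂}` with `φ(Δ_{C₁}) = Δ_{C₂}` — kernel proofs

S. Mochizuki, *Topics in Absolute Anabelian Geometry II* [AbsTopII], Cor 3.3 (ii) p. 68 and
Cor 3.4 p. 70 (manuscript pagination, lit key `paper:url-585b8d0ad0d9`; bib key
`MochizukiAbsTopII2013`).  Cor 3.3 (ii) describes "the collection of open subgroups `Π_D ⊆ Π_C` that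
arise from finite étale double coverings `D → C` that exhibit `C` as semi-elliptic" as "the
collection of open subgroups `J ⊆ Π_C` of index `2` such that `J ⋂ Δ_C` [...] is torsion-free";
abc-iut-L4-t6 typed the right-hand side as the REAL set `semiEllipticDoubleCoverSubgroups`
(`AbsTopII/EllipticAdmissible.lean`) and the comparison as the named facts `Cor_3_3_ii`
(instantiated form) / `EllipticModel.Cor_3_3_ii` (printed generality).  The comparison corollary
Cor 3.4 is deduced in print by "The construction of `φ_U` follows immediately from Corollary 3.3"
(proof p. 70) — i.e. every step of the group-theoretic algorithm, being group-theoretic, is carried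
along an isomorphism `φ : Π₁ ⥲ Π₂` with `φ(Δ₁) = Δ₂`.

PROVED here (proof-only, no new definitions) for step (ii): `φ` maps
`semiEllipticDoubleCoverSubgroups` of `1 → Δ₁ → Π₁ → G₁ → 1` ONTO that of `1 → Δ₂ → Π₂ → G₂ → 1`
(`map_mem_semiEllipticDoubleCoverSubgroups`, `image_semiEllipticDoubleCoverSubgroups_eq`); hence,
GIVEN the named fact `Cor_3_3_ii` (resp. `EllipticModel.Cor_3_3_ii`), `φ` carries the set of
subgroups `Π_D` of genuine semi-elliptic double coverings of `C₁` onto that of `C₂`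
(`Cor_3_3_ii.image_doubleCovers_eq`, `EllipticModel.image_doubleCovers_eq_of_cor_3_3_ii`) — the
step-(ii) instance of the Cor 3.4 mechanism.  HONEST FRAMING: elementary transport lemmas; the
named facts stay hypotheses; nothing here bears on [IUTchIII] Cor 3.12.
-/

noncomputable section

namespace Literature.AnabelianGeometry.AbsoluteAnabelian.AbsTopII

open FundamentalExtension

universe u

/-! ### Transport of open index-`2` subgroups with torsion-free `Δ`-part -/

section Transport

variable {E F : FundamentalExtension.{u}}

/-- Membership in the image subgroup along `φ` is membership of `φ⁻¹ y`. [folklore] -/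
private theorem mem_map_iff_symm_mem (φ : E.arith ≃ₜ* F.arith) (J : Subgroup E.arith)
    (y : F.arith) : y ∈ J.map φ.toMulEquiv.toMonoidHom ↔ φ.symm y ∈ J := by
  constructor
  · rintro ⟨x, hx, rfl⟩
    change φ.symm (φ x) ∈ J
    rwa [φ.symm_apply_apply]
  · intro h
    exact ⟨φ.symm y, h, φ.apply_symm_apply y⟩

/-- The underlying set of the image subgroup is the image set. [folklore] -/
private theorem coe_map_eq_image (φ : E.arith ≃ₜ* F.arith) (J : Subgroup E.arith) :
    ((J.map φ.toMulEquiv.toMonoidHom : Subgroup F.arith) : Set F.arith) =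
      φ '' (J : Set E.arith) := by
  ext y
  simp only [Subgroup.coe_map, Set.mem_image, SetLike.mem_coe]
  constructor
  · rintro ⟨x, hx, rfl⟩
    exact ⟨x, hx, rfl⟩
  · rintro ⟨x, hx, rfl⟩
    exact ⟨x, hx, rfl⟩

/-- Mapping back and forth along `φ` is the identity on subgroups. [folklore] -/
private theorem map_symm_map (φ : E.arith ≃ₜ* F.arith) (K : Subgroup F.arith) :
    (K.map φ.symm.toMulEquiv.toMonoidHom).map φ.toMulEquiv.toMonoidHom = K := by
  ext y
  rw [mem_map_iff_symm_mem]
  constructor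
  · rintro ⟨z, hz, h⟩
    have : z = y := by
      have h' : φ (φ.symm z) = φ (φ.symm y) := congrArg φ h
      simpa only [φ.apply_symm_apply] using h'
    rw [← this]; exact hz
  · intro hy
    exact ⟨y, hy, rfl⟩

/-- If `φ(Δ₁) = Δ₂`, the `Δ`-part of the image is the image of the `Δ`-part:
`y ∈ φ(J) ∩ Δ₂ ↔ φ⁻¹ y ∈ J ∩ Δ₁`. [cite: MochizukiAbsTopII2013, Cor 3.4 p.70] -/
theorem mem_map_inf_geom_iff (φ : E.arith ≃ₜ* F.arith)
    (hφ : E.geom.map φ.toMulEquiv.toMonoidHom = F.geom) (J : Subgroup E.arith) (y : F.arith) :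
    y ∈ J.map φ.toMulEquiv.toMonoidHom ⊓ F.geom ↔ φ.symm y ∈ J ⊓ E.geom := by
  rw [Subgroup.mem_inf, Subgroup.mem_inf, mem_map_iff_symm_mem, ← hφ, mem_map_iff_symm_mem]

/-- Torsion-freeness of `J ∩ Δ` is carried along `φ` with `φ(Δ₁) = Δ₂` (the group `φ(J) ∩ Δ₂` embeds
into — indeed is isomorphic to — `J ∩ Δ₁`). [cite: MochizukiAbsTopII2013, Cor 3.3 (ii) p.68] -/
theorem isMulTorsionFree_map_inf_geom (φ : E.arith ≃ₜ* F.arith)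
    (hφ : E.geom.map φ.toMulEquiv.toMonoidHom = F.geom) {J : Subgroup E.arith}
    (hJ : IsMulTorsionFree ↥(J ⊓ E.geom)) :
    IsMulTorsionFree ↥(J.map φ.toMulEquiv.toMonoidHom ⊓ F.geom) := by
  -- the injective homomorphism `φ(J) ∩ Δ₂ → J ∩ Δ₁`, `y ↦ φ⁻¹ y`
  let f : ↥(J.map φ.toMulEquiv.toMonoidHom ⊓ F.geom) →* ↥(J ⊓ E.geom) :=
    { toFun := fun y => ⟨φ.symm y, (mem_map_inf_geom_iff φ hφ J y).mp y.2⟩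
      map_one' := Subtype.ext (map_one φ.symm)
      map_mul' := fun a b => Subtype.ext (map_mul φ.symm (a : F.arith) (b : F.arith)) }
  have hf : Function.Injective f := by
    intro a b h
    have h' : φ.symm (a : F.arith) = φ.symm (b : F.arith) := congrArg Subtype.val h
    exact Subtype.ext (φ.symm.injective h')
  exact hf.isMulTorsionFree f

/-- **Cor 3.3 (ii)'s description is group-theoretic, hence `φ`-invariant**: an open subgroup
`J ⊆ Π₁` of index `2` with `J ∩ Δ₁` torsion-free is mapped by `φ : Π₁ ⥲ Π₂` (with
`φ(Δ₁) = Δ₂`) to such a subgroup of `Π₂`. [cite: MochizukiAbsTopII2013, Cor 3.3 (ii) p.68] -/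
theorem map_mem_semiEllipticDoubleCoverSubgroups (φ : E.arith ≃ₜ* F.arith)
    (hφ : E.geom.map φ.toMulEquiv.toMonoidHom = F.geom) {J : Subgroup E.arith}
    (hJ : J ∈ semiEllipticDoubleCoverSubgroups E) :
    J.map φ.toMulEquiv.toMonoidHom ∈ semiEllipticDoubleCoverSubgroups F := by
  obtain ⟨hopen, hindex, htf⟩ := hJ
  refine ⟨?_, ?_, isMulTorsionFree_map_inf_geom φ hφ htf⟩
  · rw [coe_map_eq_image]
    exact φ.toHomeomorph.isOpenMap _ hopen
  · rw [← hindex]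
    exact Subgroup.index_map_of_bijective
      (show Function.Bijective φ.toMulEquiv.toMonoidHom from φ.bijective) J

/-- The inverse isomorphism also preserves `Δ`. [folklore] -/
private theorem geom_map_symm (φ : E.arith ≃ₜ* F.arith)
    (hφ : E.geom.map φ.toMulEquiv.toMonoidHom = F.geom) :
    F.geom.map φ.symm.toMulEquiv.toMonoidHom = E.geom := by
  ext x
  rw [mem_map_iff_symm_mem, φ.symm_symm, ← hφ, mem_map_iff_symm_mem, φ.symm_apply_apply]

/-- **Set-level form**: `φ` induces a BIJECTION between the two group-theoretic collections of
Cor 3.3 (ii): the image of `semiEllipticDoubleCoverSubgroups (Π₁ ↠ G₁)` under `J ↦ φ(J)` is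
`semiEllipticDoubleCoverSubgroups (Π₂ ↠ G₂)`. [cite: MochizukiAbsTopII2013, Cor 3.3 (ii) p.68] -/
theorem image_semiEllipticDoubleCoverSubgroups_eq (φ : E.arith ≃ₜ* F.arith)
    (hφ : E.geom.map φ.toMulEquiv.toMonoidHom = F.geom) :
    (fun J : Subgroup E.arith => J.map φ.toMulEquiv.toMonoidHom) ''
        semiEllipticDoubleCoverSubgroups E = semiEllipticDoubleCoverSubgroups F := by
  ext K
  constructor
  · rintro ⟨J, hJ, rfl⟩
    exact map_mem_semiEllipticDoubleCoverSubgroups φ hφ hJ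
  · intro hK
    refine ⟨K.map φ.symm.toMulEquiv.toMonoidHom,
      map_mem_semiEllipticDoubleCoverSubgroups φ.symm (geom_map_symm φ hφ) hK, ?_⟩
    exact map_symm_map φ K

end Transport

/-! ### The comparison consequence of `Cor_3_3_ii` (instantiated form) -/

/-- **Cor 3.3 (ii) ⟹ its comparison version** (the step-(ii) instance of "The construction of `φ_U`
follows immediately from Corollary 3.3", Cor 3.4 proof p. 70), PROVED from the named fact: for
semi-elliptic `C₁, C₂` of a model satisfying `Cor_3_3_ii` and `φ : Π_{C₁} ⥲ Π_{C₂}` with `φ(Δ_{C₁})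
= Δ_{C₂}`, `φ` carries the set of subgroups `Π_D ⊆ Π_{C₁}` of the semi-elliptic double coverings `D
→ C₁` ONTO the corresponding set for `C₂`. [cite: MochizukiAbsTopII2013, Cor 3.4 p.70] -/
theorem Cor_3_3_ii.image_doubleCovers_eq {M : IsogenyModel.{u}} (h : Cor_3_3_ii M)
    {C₁ C₂ : M.Curve} (hC₁ : M.IsSemiElliptic C₁) (hC₂ : M.IsSemiElliptic C₂)
    (φ : (M.ext C₁).arith ≃ₜ* (M.ext C₂).arith)
    (hφ : (M.ext C₁).geom.map φ.toMulEquiv.toMonoidHom = (M.ext C₂).geom) :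
    (fun J : Subgroup (M.ext C₁).arith => J.map φ.toMulEquiv.toMonoidHom) ''
        {J | ∃ (D : M.Curve) (f : M.FinEt D C₁), M.IsOver f ∧ M.IsOncePuncturedElliptic D ∧
          M.degree f = 2 ∧ J = M.arithImage f} =
      {J | ∃ (D : M.Curve) (f : M.FinEt D C₂), M.IsOver f ∧ M.IsOncePuncturedElliptic D ∧
          M.degree f = 2 ∧ J = M.arithImage f} := by
  rw [h C₁ hC₁, h C₂ hC₂]
  exact image_semiEllipticDoubleCoverSubgroups_eq φ hφ

/-! ### The comparison consequence of `EllipticModel.Cor_3_3_ii` (printed generality) -/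

namespace EllipticModel

open AbsTopI

variable {𝒟 : ConstructionDataClass.{u}} (M : EllipticModel 𝒟)

/-- **Cor 3.3 (ii) ⟹ its comparison version, printed generality** (step (ii) of the Cor 3.4
mechanism, PROVED from `EllipticModel.Cor_3_3_ii`): for two members `X₁/k_{b₁}`, `X₂/k_{b₂}`
satisfying the standing hypotheses and an isomorphism of the `Π_C`'s of their cores carrying
`Δ_{C₁}` onto `Δ_{C₂}`, the sets of double-covering subgroups `Π_D` correspond under `φ`.
[cite: MochizukiAbsTopII2013, Cor 3.4 p.70] -/
theorem image_doubleCovers_eq_of_cor_3_3_ii (h : M.Cor_3_3_ii) (hfull : 𝒟.IsChainFull)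
    (hGC : 𝒟.RelIsomDGC) {b₁ b₂ : 𝒟.Base} {X₁ : (𝒟.datum b₁).Obj} {X₂ : (𝒟.datum b₂).Obj}
    (hX₁ : M.IsCor33Member b₁ X₁) (hX₂ : M.IsCor33Member b₂ X₂)
    (φ : (M.coreExt b₁ X₁).arith ≃ₜ* (M.coreExt b₂ X₂).arith)
    (hφ : (M.coreExt b₁ X₁).geom.map φ.toMulEquiv.toMonoidHom = (M.coreExt b₂ X₂).geom) :
    (fun J : Subgroup (M.coreExt b₁ X₁).arith => J.map φ.toMulEquiv.toMonoidHom) ''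
        M.doubleCovers b₁ X₁ = M.doubleCovers b₂ X₂ := by
  rw [h hfull hGC b₁ X₁ hX₁, h hfull hGC b₂ X₂ hX₂]
  exact image_semiEllipticDoubleCoverSubgroups_eq φ hφ

/-- In particular the setting subgroup `Π_{D₁}` of any setting of `X₁` is carried by `φ` to a member
of `doubleCovers` of `X₂` (given `Cor_3_3_ii`). [cite: MochizukiAbsTopII2013, Cor 3.4 p.70] -/
theorem map_PiD_mem_doubleCovers_of_cor_3_3_ii (h : M.Cor_3_3_ii) (hfull : 𝒟.IsChainFull)
    (hGC : 𝒟.RelIsomDGC) {b₁ b₂ : 𝒟.Base} {X₁ : (𝒟.datum b₁).Obj} {X₂ : (𝒟.datum b₂).Obj}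
    (hX₁ : M.IsCor33Member b₁ X₁) (hX₂ : M.IsCor33Member b₂ X₂)
    (φ : (M.coreExt b₁ X₁).arith ≃ₜ* (M.coreExt b₂ X₂).arith)
    (hφ : (M.coreExt b₁ X₁).geom.map φ.toMulEquiv.toMonoidHom = (M.coreExt b₂ X₂).geom)
    (s₁ : M.Setting b₁ X₁) :
    (M.PiD s₁).map φ.toMulEquiv.toMonoidHom ∈ M.doubleCovers b₂ X₂ := by
  rw [← M.image_doubleCovers_eq_of_cor_3_3_ii h hfull hGC hX₁ hX₂ φ hφ]
  exact ⟨M.PiD s₁, M.PiD_mem s₁, rfl⟩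

end EllipticModel

end Literature.AnabelianGeometry.AbsoluteAnabelian.AbsTopII
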